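import Literature.NumberTheory.LFunctions.DirichletRealZeroHoffsteinWindow
import HarnessLib

/-!
# Stark's box and Hoffstein's window for a real primitive Dirichlet character: the exceptional
# zero of `L(s, χ)` is unique, real and SIMPLE — PROVED by transport from the quadratic field

Topic `Literature/NumberTheory/LFunctions` (namespace `Literature.NumberTheory.LFunctions`; helpers in
the sub-namespace `HoffsteinWindow`). PROOF-ONLY module (D-0014/D-0026, kernel lane): theorems, no
definitions, no named facts. Cell `landau-siegel` §C (typer pool), OFFER-D 2026-08-27.

For a PRIMITIVE quadratic Dirichlet character `χ ≠ χ₀` mod `q` let `K` be the quadratic field with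
`ζ_K(s) = ζ(s) L(s, χ)`, `|d_K| = q` (`HoffsteinWindow.exists_quadraticField`, sibling module,
Montgomery–Vaughan Thm 9.13 / §10.1 Ex. 26 as proved in the tree). Since `ζ(s) ≠ 0` for real
`0 < s < 1` and off the zeros of `ζ`, the multiplicity of a zero of `L(s, χ)` equals its multiplicity
as a zero of the entire `ζ₁_K = (s − 1)ζ_K` (`HoffsteinWindow.analyticOrderAt_LFunction_eq`,
Mathlib's additivity `analyticOrderAt_mul`). Transporting the tree's PROVED number-field theorems:

* **Stark 1974, Lemma 3** (`NumberField.Stark1974_atMostOneZero_holds`, Murty–Murty Ch. 2 Prop. 6.1)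
  ⇒ `starkBox_realCharacter`: the zeros `ρ` of `L(s, χ)` with `Re ρ ≥ 1 − 1/(4 log q)`,
  `|Im ρ| ≤ 1/(4 log q)` (the tree's `NumberField.starkBox q`) form a subsingleton, and such a zero is
  real and simple. [cite: Stark1974, Lemma 3] [cite: MurtyMurty1997, Ch. 2 Prop. 6.1]
* **Hoffstein 1980, Lemma 2 = Chen 2007, Lemma 1** (`chen2007_lemma1`) ⇒
  `realZero_hoffsteinWindow_simple`: a real zero `β` of `L(s, χ)` with `1 − β < (6 − 4√2)/log q` is
  simple (uniqueness: sibling module, `HoffsteinWindow.realZeros_subsingleton`).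
  [cite: Hoffstein1980SiegelTatuzawa, Lemma 2 p. 169] [cite: Chen2007SiegelTatuzawaHoffstein, Lemma 1 p. 362]

These are the classical statements for `ζ(s)L(s, χ_d)` read back on `L(s, χ_d)` (Hoffstein's own use,
proof of Lemma 3, p. 170). The explicit zero-free region of record for all characters stays the named
fact `McCurley1984_theorem1`; nothing here asserts it.

«The programme SEARCHES and TYPES; no claim about Landau–Siegel zeros, Theorems 1–2 of
arXiv:2211.02515 or a repaired Margin232 until a kernel theorem says so.»

## References

* [Stark1974] H. M. Stark, *Some effective cases of the Brauer–Siegel theorem*, Invent. Math. 23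
  (1974) 135–152 — Lemma 3.
* [MurtyMurty1997] M. R. Murty, V. K. Murty, *Non-vanishing of L-functions and Applications*,
  Birkhäuser 1997 — Ch. 2 Prop. 6.1.
* [Hoffstein1980SiegelTatuzawa] J. Hoffstein, Acta Arith. 38 (1980) 167–174 — Lemma 2 p. 169, p. 170.
* [Chen2007SiegelTatuzawaHoffstein] Y.-G. Chen, Acta Arith. 130 (2007) 361–367 — Lemma 1 p. 362.
* [MontgomeryVaughan2007] Multiplicative Number Theory I — Thm 9.13, §10.1 Ex. 26.
-/

noncomputable section

open scoped NumberField ComplexOrder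
open Complex Set Filter Topology NumberField DirichletCharacter

namespace Literature.NumberTheory.LFunctions

namespace HoffsteinWindow

/-- A primitive character `χ ≠ 1` has modulus `> 1`. [folklore] -/
private theorem one_lt_level' {q : ℕ} [NeZero q] {χ : DirichletCharacter ℂ q} (h1 : χ ≠ 1) :
    1 < q := by
  have hq0 : q ≠ 0 := NeZero.ne q
  by_contra h
  have hq : q = 1 := by omega
  subst hq
  exact h1 (level_one χ)

/-- A zero of `L(s, χ)` (`χ ≠ χ₀`) is not `1` and has `Re < 1`. [folklore] -/
private theorem re_lt_one_of_zero {q : ℕ} [NeZero q] {χ : DirichletCharacter ℂ q} (h1 : χ ≠ 1)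
    {ρ : ℂ} (hz : χ.LFunction ρ = 0) : ρ.re < 1 := by
  by_contra h
  exact DirichletCharacter.LFunction_ne_zero_of_one_le_re χ (Or.inl h1) (not_lt.mp h) hz

/-- **Multiplicity transfer.** If `ζ_K(s) = ζ(s)L(s, χ)` off `s = 1` (`χ ≠ χ₀`), then at every
`s ≠ 1` with `ζ(s) ≠ 0` the order of vanishing of `L(·, χ)` equals that of the entire
`ζ₁_K = (s−1)ζ_K` (additivity of the analytic order; `(s−1)ζ(s) ≠ 0` there).
[cite: MontgomeryVaughan2007, §10.1 Exercise 26] -/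
theorem analyticOrderAt_LFunction_eq {q : ℕ} [NeZero q] {χ : DirichletCharacter ℂ q} (h1 : χ ≠ 1)
    {K : Type} [Field K] [NumberField K]
    (hfac : ∀ s : ℂ, s ≠ 1 → dedekindZetaCont K s = riemannZeta s * χ.LFunction s)
    {s : ℂ} (hs : s ≠ 1) (hζ : riemannZeta s ≠ 0) :
    analyticOrderAt χ.LFunction s = analyticOrderAt (dedekindZeta₁ K) s := by
  -- `ζ₁_K = ((· − 1)·ζ) · L(·,χ)` near `s`
  have hEq : dedekindZeta₁ K =ᶠ[𝓝 s] ((fun z ↦ (z - 1) * riemannZeta z) * χ.LFunction) := by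
    filter_upwards [isOpen_compl_singleton.mem_nhds hs] with z hz
    have hz1 : z ≠ 1 := hz
    rw [Pi.mul_apply, dedekindZeta₁_apply_of_ne_one hz1, hfac z hz1, mul_assoc]
  have hζan : AnalyticAt ℂ riemannZeta s :=
    DifferentiableOn.analyticAt (s := {(1 : ℂ)}ᶜ)
      (fun z hz ↦ (differentiableAt_riemannZeta hz).differentiableWithinAt)
      (isOpen_compl_singleton.mem_nhds hs)
  have hfan : AnalyticAt ℂ (fun z ↦ (z - 1) * riemannZeta z) s :=
    (analyticAt_id.sub analyticAt_const).mul hζan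
  have hLan : AnalyticAt ℂ χ.LFunction s := (differentiable_LFunction h1).analyticAt s
  have hf0 : analyticOrderAt (fun z ↦ (z - 1) * riemannZeta z) s = 0 := by
    rw [hfan.analyticOrderAt_eq_zero]
    exact mul_ne_zero (sub_ne_zero.mpr hs) hζ
  rw [analyticOrderAt_congr hEq, analyticOrderAt_mul hfan hLan, hf0, zero_add]

end HoffsteinWindow

open HoffsteinWindow

/-- **A real zero of `L(s, χ)` in Hoffstein's window is simple** (`χ` primitive quadratic,
`χ ≠ χ₀`, mod `q`): if `L(β, χ) = 0` with `1 − β < (6 − 4√2)/log q`, then `ord_{s=β} L(s, χ) = 1`.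
(Hoffstein's Lemma 2 = Chen's Lemma 1, "at most one real simple zero", on the quadratic field `K`
with `ζ_K = ζ · L(χ)`; the uniqueness half is `HoffsteinWindow.realZeros_subsingleton`.)
[cite: Hoffstein1980SiegelTatuzawa, Lemma 2 p. 169] [cite: Chen2007SiegelTatuzawaHoffstein, Lemma 1 p. 362] -/
theorem realZero_hoffsteinWindow_simple {q : ℕ} [NeZero q] {χ : DirichletCharacter ℂ q}
    (hprim : χ.IsPrimitive) (hquad : χ.IsQuadratic) (h1 : χ ≠ 1) {β : ℝ}
    (hz : χ.LFunction β = 0) (hw : 1 - β < (6 - 4 * Real.sqrt 2) / Real.log q) :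
    analyticOrderAt χ.LFunction β = 1 := by
  obtain ⟨K, hF, hNF, h2, hdq, hfac⟩ := exists_quadraticField hprim hquad h1
  obtain ⟨-, hsimple⟩ := chen2007_lemma1 K (by omega)
  rw [hdq] at hsimple
  have hβ1 : β < 1 := by
    have h := HoffsteinWindow.re_lt_one_of_zero h1 hz
    simpa using h
  -- `β > 0`: the window has width `< 1/2` (`q ≥ 2`, `6 − 4√2 < 0.35 < ½ log 2`)
  have hβ0 : 0 < β := by
    have hq1 : 1 < q := HoffsteinWindow.one_lt_level' h1
    have h2q : (2 : ℝ) ≤ q := by exact_mod_cast hq1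
    have hlog2 : (0.6931471803 : ℝ) < Real.log 2 := Real.log_two_gt_d9
    have hlogq : Real.log 2 ≤ Real.log q := Real.log_le_log (by norm_num) h2q
    have hlogq0 : 0 < Real.log (q : ℝ) := by linarith
    obtain ⟨-, hc2⟩ := NumberField.chenConst_bounds
    have hwin : (6 - 4 * Real.sqrt 2) / Real.log q < 1 / 2 := by
      rw [div_lt_iff₀ hlogq0]; linarith
    linarith
  have hβ1' : (β : ℂ) ≠ 1 := by
    intro h
    have := congrArg Complex.re h
    simp at this
    linarith
  have hζ : riemannZeta β ≠ 0 := (riemannZeta_neg_of_pos_of_lt_one hβ0 hβ1).ne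
  have hζ₁ : dedekindZeta₁ K β = 0 := by
    rw [dedekindZeta₁_apply_of_ne_one hβ1', hfac β hβ1', hz, mul_zero, mul_zero]
  rw [HoffsteinWindow.analyticOrderAt_LFunction_eq h1 hfac hβ1' hζ]
  exact hsimple β hζ₁ hw

/-- **Stark's box for a real primitive character** (Stark 1974 Lemma 3 = Murty–Murty Ch. 2
Prop. 6.1 on the quadratic field `K`, `ζ_K = ζ · L(χ)`, `|d_K| = q`): for `χ` primitive quadratic,
`χ ≠ χ₀`, mod `q`, the zeros `ρ` of `L(s, χ)` in the box `Re ρ ≥ 1 − 1/(4 log q)`,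
`|Im ρ| ≤ 1/(4 log q)` (`NumberField.starkBox q`) form a subsingleton, and any such zero is REAL and
SIMPLE. [cite: Stark1974, Lemma 3] [cite: MurtyMurty1997, Ch. 2 Prop. 6.1] -/
theorem starkBox_realCharacter {q : ℕ} [NeZero q] {χ : DirichletCharacter ℂ q}
    (hprim : χ.IsPrimitive) (hquad : χ.IsQuadratic) (h1 : χ ≠ 1) :
    {ρ : ℂ | χ.LFunction ρ = 0 ∧ ρ ∈ NumberField.starkBox (q : ℝ)}.Subsingleton ∧
      ∀ ρ : ℂ, χ.LFunction ρ = 0 → ρ ∈ NumberField.starkBox (q : ℝ) →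
        ρ.im = 0 ∧ analyticOrderAt χ.LFunction ρ = 1 := by
  obtain ⟨K, hF, hNF, h2, hdq, hfac⟩ := exists_quadraticField hprim hquad h1
  obtain ⟨hsub, hreal⟩ := NumberField.Stark1974_atMostOneZero_holds K (by omega)
  rw [hdq] at hsub hreal
  -- a zero of `L(s, χ)` is a zero of `ζ₁_K`
  have hzero : ∀ ρ : ℂ, χ.LFunction ρ = 0 → dedekindZeta₁ K ρ = 0 := by
    intro ρ hz
    have hρ1 : ρ ≠ 1 := by
      intro h
      have hlt := HoffsteinWindow.re_lt_one_of_zero h1 hz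
      rw [h, one_re] at hlt
      exact lt_irrefl _ hlt
    rw [dedekindZeta₁_apply_of_ne_one hρ1, hfac ρ hρ1, hz, mul_zero, mul_zero]
  refine ⟨fun ρ hρ ρ' hρ' ↦ hsub ⟨hzero ρ hρ.1, hρ.2⟩ ⟨hzero ρ' hρ'.1, hρ'.2⟩, ?_⟩
  intro ρ hz hbox
  obtain ⟨him, hord⟩ := hreal ρ (hzero ρ hz) hbox
  refine ⟨him, ?_⟩
  -- `ρ` is real with `0 < Re ρ < 1`, so `ζ(ρ) ≠ 0`
  have hq1 : 1 < q := HoffsteinWindow.one_lt_level' h1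
  have h2q : (2 : ℝ) ≤ q := by exact_mod_cast hq1
  have hlog2 : (0.6931471803 : ℝ) < Real.log 2 := Real.log_two_gt_d9
  have hlogq : Real.log 2 ≤ Real.log q := Real.log_le_log (by norm_num) h2q
  have hlogq0 : 0 < Real.log (q : ℝ) := by linarith
  have hre1 : ρ.re < 1 := HoffsteinWindow.re_lt_one_of_zero h1 hz
  have hre0 : 0 < ρ.re := by
    rw [NumberField.mem_starkBox_iff] at hbox
    have hwin : 1 / (4 * Real.log (q : ℝ)) < 1 := by
      rw [div_lt_one (by positivity)]; linarith
    linarith [hbox.1]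
  have hρ : ρ = ((ρ.re : ℝ) : ℂ) := by
    apply Complex.ext <;> simp [him]
  have hρ1 : ρ ≠ 1 := by
    intro h; rw [h, one_re] at hre1; exact lt_irrefl _ hre1
  have hζ : riemannZeta ρ ≠ 0 := by
    rw [hρ]
    exact (riemannZeta_neg_of_pos_of_lt_one hre0 hre1).ne
  rw [HoffsteinWindow.analyticOrderAt_LFunction_eq h1 hfac hρ1 hζ]
  exact hord

namespace HoffsteinWindow

/-- A zero `ρ` with `Re ρ > 0` of `L(s, χ)` (`χ ≠ χ₀`) is a zero of `L(s, χ*)` for the primitive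
character `χ*` inducing `χ`: the Euler factors `1 − χ*(p)p^{−ρ}`, `p ∣ q`, have
`‖χ*(p)p^{−ρ}‖ ≤ p^{−Re ρ} < 1`. [folklore] -/
private theorem primitiveCharacter_LFunction_eq_zero_of_re_pos {q : ℕ} [NeZero q]
    {χ : DirichletCharacter ℂ q} [NeZero χ.conductor] (h1 : χ ≠ 1) {ρ : ℂ} (hρ : 0 < ρ.re)
    (hz : χ.LFunction ρ = 0) : χ.primitiveCharacter.LFunction ρ = 0 := by
  have hne : χ.primitiveCharacter ≠ 1 := by
    intro h
    apply h1
    rw [← changeLevel_primitiveCharacter χ, h, map_one]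
  have h := LFunction_changeLevel χ.conductor_dvd_level χ.primitiveCharacter (s := ρ) (Or.inl hne)
  rw [changeLevel_primitiveCharacter, hz] at h
  rcases mul_eq_zero.mp h.symm with h0 | h0
  · exact h0
  · exfalso
    obtain ⟨p, hp, hp0⟩ := Finset.prod_eq_zero_iff.mp h0
    have hpp : p.Prime := Nat.prime_of_mem_primeFactors hp
    have hp2 : (2 : ℝ) ≤ p := by exact_mod_cast hpp.two_le
    have hnorm : ‖χ.primitiveCharacter p * (p : ℂ) ^ (-ρ)‖ < 1 := by
      rw [norm_mul, Complex.norm_natCast_cpow_of_pos hpp.pos]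
      have hre : (-ρ).re = -ρ.re := by simp
      rw [hre]
      have h1' : ((p : ℝ)) ^ (-ρ.re) < 1 :=
        Real.rpow_lt_one_of_one_lt_of_neg (by linarith) (by linarith)
      have hχ := DirichletCharacter.norm_le_one χ.primitiveCharacter (p : ZMod χ.conductor)
      have h0' : 0 ≤ (p : ℝ) ^ (-ρ.re) := Real.rpow_nonneg (by linarith) _
      calc ‖χ.primitiveCharacter p‖ * (p : ℝ) ^ (-ρ.re) ≤ 1 * (p : ℝ) ^ (-ρ.re) :=
            mul_le_mul_of_nonneg_right hχ h0'
        _ < 1 := by rw [one_mul]; exact h1'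
    have heq : χ.primitiveCharacter p * (p : ℂ) ^ (-ρ) = 1 := (sub_eq_zero.mp hp0).symm
    rw [heq, norm_one] at hnorm
    exact lt_irrefl _ hnorm

/-- The primitive character inducing a quadratic character is quadratic. [folklore] -/
private theorem isQuadratic_primitiveCharacter' {q : ℕ} [NeZero q] {χ : DirichletCharacter ℂ q}
    (hquad : χ.IsQuadratic) : χ.primitiveCharacter.IsQuadratic := by
  haveI : NeZero χ.conductor := ⟨χ.conductor_ne_zero⟩
  have hsq : χ ^ 2 = 1 := hquad.sq_eq_one
  have hsq₀ : χ.primitiveCharacter ^ 2 = 1 := by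
    refine (changeLevel_eq_one_iff χ.conductor_dvd_level).mp ?_
    rw [map_pow, changeLevel_primitiveCharacter, hsq]
  intro a
  by_cases ha : IsUnit a
  · right
    have h := MulChar.pow_apply' χ.primitiveCharacter two_ne_zero a
    rw [hsq₀, MulChar.one_apply ha] at h
    have h2 : χ.primitiveCharacter a * χ.primitiveCharacter a = 1 := by
      rw [← pow_two]; exact h.symm
    rcases mul_self_eq_one_iff.mp h2 with h' | h'
    · exact Or.inl h'
    · exact Or.inr h'
  · exact Or.inl (χ.primitiveCharacter.map_nonunit ha)

/-- Stark's box shrinks as the modulus grows: `starkBox q ⊆ starkBox q*` for `2 ≤ q* ≤ q`.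
[cite: Stark1974, Lemma 3 (the box)] -/
private theorem starkBox_mono {q q' : ℕ} (hq' : 2 ≤ q') (hle : q' ≤ q) :
    NumberField.starkBox (q : ℝ) ⊆ NumberField.starkBox (q' : ℝ) := by
  intro ρ hρ
  rw [NumberField.mem_starkBox_iff] at hρ ⊢
  have h2 : (2 : ℝ) ≤ q' := by exact_mod_cast hq'
  have hle' : (q' : ℝ) ≤ q := by exact_mod_cast hle
  have hlog' : 0 < Real.log (q' : ℝ) := Real.log_pos (by linarith)
  have hlogle : Real.log (q' : ℝ) ≤ Real.log (q : ℝ) := Real.log_le_log (by linarith) hle'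
  have hmono : 1 / (4 * Real.log (q : ℝ)) ≤ 1 / (4 * Real.log (q' : ℝ)) :=
    one_div_le_one_div_of_le (by positivity) (by linarith)
  exact ⟨by linarith [hρ.1], hρ.2.trans hmono⟩

end HoffsteinWindow

/-- **Stark's box for every real non-principal character**: for `χ` quadratic, `χ ≠ χ₀`, mod `q`
(primitive or not), the zeros of `L(s, χ)` in `NumberField.starkBox q` form a subsingleton and are
real. (Imprimitive `χ`: a zero with `Re ρ > 0` is a zero of `L(s, χ*)`, `χ*` primitive mod
`q* ∣ q`, `q* ≥ 2`, and `starkBox q ⊆ starkBox q*`.) [cite: Stark1974, Lemma 3]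
[cite: MurtyMurty1997, Ch. 2 Prop. 6.1] -/
theorem starkBox_realCharacter' {q : ℕ} [NeZero q] {χ : DirichletCharacter ℂ q}
    (hquad : χ.IsQuadratic) (h1 : χ ≠ 1) :
    {ρ : ℂ | χ.LFunction ρ = 0 ∧ ρ ∈ NumberField.starkBox (q : ℝ)}.Subsingleton ∧
      ∀ ρ : ℂ, χ.LFunction ρ = 0 → ρ ∈ NumberField.starkBox (q : ℝ) → ρ.im = 0 := by
  haveI : NeZero χ.conductor := ⟨χ.conductor_ne_zero⟩
  have hq1 : 1 < q := HoffsteinWindow.one_lt_level' h1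
  have hcond1 : χ.conductor ≠ 1 := fun h ↦ h1 (eq_one_iff_conductor_eq_one.mpr h)
  have hcond2 : 2 ≤ χ.conductor := by have := χ.conductor_ne_zero; omega
  have hcondq : χ.conductor ≤ q := Nat.le_of_dvd (by omega) χ.conductor_dvd_level
  have hsub := HoffsteinWindow.starkBox_mono hcond2 hcondq
  have hne₀ : χ.primitiveCharacter ≠ 1 := by
    intro h
    apply h1
    rw [← changeLevel_primitiveCharacter χ, h, map_one]
  obtain ⟨hS, hR⟩ := starkBox_realCharacter χ.primitiveCharacter_isPrimitive
    (HoffsteinWindow.isQuadratic_primitiveCharacter' hquad) hne₀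
  -- zeros in the box have `Re ρ > 0`, hence are zeros of `L(s, χ*)` in the box of `q*`
  have hpos : ∀ ρ : ℂ, ρ ∈ NumberField.starkBox (q : ℝ) → 0 < ρ.re := by
    intro ρ hρ
    rw [NumberField.mem_starkBox_iff] at hρ
    have h2q : (2 : ℝ) ≤ q := by exact_mod_cast hq1
    have hlog2 : (0.6931471803 : ℝ) < Real.log 2 := Real.log_two_gt_d9
    have hlogq : Real.log 2 ≤ Real.log q := Real.log_le_log (by norm_num) h2q
    have hwin : 1 / (4 * Real.log (q : ℝ)) < 1 := by
      rw [div_lt_one (by linarith)]; linarith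
    linarith [hρ.1]
  have htr : ∀ ρ : ℂ, χ.LFunction ρ = 0 → ρ ∈ NumberField.starkBox (q : ℝ) →
      χ.primitiveCharacter.LFunction ρ = 0 ∧ ρ ∈ NumberField.starkBox (χ.conductor : ℝ) :=
    fun ρ hz hρ ↦ ⟨HoffsteinWindow.primitiveCharacter_LFunction_eq_zero_of_re_pos h1 (hpos ρ hρ) hz,
      hsub hρ⟩
  exact ⟨fun ρ hρ ρ' hρ' ↦ hS (htr ρ hρ.1 hρ.2) (htr ρ' hρ'.1 hρ'.2),
    fun ρ hz hρ ↦ (hR ρ (htr ρ hz hρ).1 (htr ρ hz hρ).2).1⟩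

end Literature.NumberTheory.LFunctions
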